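import Summits.AnomalousDissipation.AnomalousDissipation.Theorems.SolenoidalFractalHomogenisationLagrangianStepFrameRate
import Summits.AnomalousDissipation.AnomalousDissipation.Theorems.SolenoidalFractalHomogenisationLagrangianStepFrameModulationClosed
import Summits.AnomalousDissipation.AnomalousDissipation.Theorems.SolenoidalFractalHomogenisationLagrangianCarrierAnalyticTower
import Summits.AnomalousDissipation.AnomalousDissipation.Theorems.SolenoidalFractalHomogenisationLagrangianCarrierAnalyticFlow
import Literature.Analysis.ODE.TorusFlowSecondGradientWithin

/-!
# K1L_D (stmt-AnomalousDissipation-27980), `stub_Z7_alphaBetaR` α-part, K8-5 (i): the SHARP second gradient of the coarse-flow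
# displacement on a CLOSED refresh piece, `|∂_e∂_c D_q(u,y)| ≤ C₂·N_m·(Σ_{i<m} a (i+1))·u` (helper, `--supports 27980 --as helper`)

prover lead-k1l-onelevel-p1 g6 (K8-5 road of prover ad-k3l-bookkeeping-p1 g8).  The hypothesis `hcurv` of
`FrameForm.isModulation_frameG_closed` (p704979) — the sharp curvature `|∂_c (frameG)_{il}| ≤ C♯·N_m·strain m` of the inverse frame — is
proved in the companion `…LagrangianStepFrameCurvature`; this file supplies its three analytic inputs, all uniform over `LPermissible`,
`Regular` carriers of a fixed design `W` with `N_m² ≤ N_{m+1}` and the template (T4) below a ceiling `θs(k, W)`: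
* §1 `abs_partialDeriv_partialDeriv_partialSum_le` — `|∂_p∂_q (b_{≤m})_a| ≤ C₂·N_m·Σ_{i<m} a (i+1)`: the analytic tower
  (`LagrangianCarrierAnalytic.analytic_tower`, p-k3l g8) at order two through `dnorm_partialSum_le` (design `W = W.stretch 1`);
* §2 `abs_partialDeriv_disp_le_one_closed` — `|∂_c D_q| ≤ 1` on the CLOSED piece `[jR, jR+T]`, `T ≤ refresh (m+1)`
  (`flowDeriv_sub_id_le_strain` on the half-open window, endpoint by continuity `continuousOn_frameJac_entry_closed`);
* §3 `abs_partialDeriv_partialDeriv_disp_le_closed` — the generic within-window estimate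
  `TorusFlow.abs_partialDeriv_partialDeriv_disp_le_forward_ofDerivWithin` (p706114) fed with §1, §2, `abs_partialDeriv_partialSum_le`
  (`B₁ = C'·Σ a`, `3B₁T ≤ 3C'·strain m ≤ 1`) and the chain rule on steroids within the closed window
  (`TorusFlow.hasDerivWithinAt_iterPartialDeriv_disp` on `window_b_clauses` / `FrameConj.window_disp_clauses_closed`).
No sorry, no definition, no named fact.  NOT a proof of the stub, of K1L_D or of AD; rung F-D1.A0.
-/

set_option linter.dupNamespace false

noncomputable section

namespace Summit.AnomalousDissipation.AnomalousDissipation.Theorems.SolenoidalFractalHomogenisation.LagrangianStep.FrameForm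

open Set Function Filter MeasureTheory Topology
open scoped NNReal
open Literature.Analysis Literature.Analysis.ODE Literature.Analysis.ODE.TorusFlow Literature.Analysis.FunctionSpaces
open Literature.Analysis.FunctionSpaces.Torus
open Literature.Analysis.FluidPDE Literature.Analysis.FluidPDE.LatticeShear
open Summit.AnomalousDissipation.AnomalousDissipation.Theorems.SolenoidalFractalHomogenisation.LagrangianCarrierConstruction
open Summit.AnomalousDissipation.AnomalousDissipation.Theorems.SolenoidalFractalHomogenisation.LagrangianCarrier
open Summit.AnomalousDissipation.AnomalousDissipation.Theorems.SolenoidalFractalHomogenisation.LagrangianCarrierAnalytic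

variable {k : ℕ}

/-! ## §0 Tools -/

/-- Stretching a word by the factor `1` does nothing. [folklore] -/
theorem stretch_one (W : LatticeWord k) : W.stretch 1 one_pos = W := by
  cases W with
  | mk phase ramp pos ramp_pos ramp_le =>
    simp only [LatticeWord.stretch, one_mul]

/-- The template (T4) `θ(m+1)·(N(m+1)/N m)^{1/16} ≤ θ₀` gives `θ(m+1) ≤ θ₀` along a permissible cascade. [folklore] -/
theorem theta_le_of_template (E : LagrangianLatticeCarrier k) (hP : E.LPermissible) {θ₀ : ℝ}
    (hT4 : ∀ m, E.θ (m + 1) * ((E.N (m + 1) : ℝ) / E.N m) ^ (1 / 16 : ℝ) ≤ θ₀) (m : ℕ) : E.θ (m + 1) ≤ θ₀ := by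
  have hN2 : ∀ m, 2 * E.N m ≤ E.N (m + 1) := hP.permissible.2.2.1
  have hNpos : ∀ m, (0 : ℝ) < E.N m := fun m => by exact_mod_cast E.toFractalCarrierData.N_pos m
  have hNmono : (E.N m : ℝ) ≤ E.N (m + 1) := by
    have h : (2 : ℝ) * E.N m ≤ E.N (m + 1) := by exact_mod_cast hN2 m
    linarith [hNpos m]
  have hr : (1 : ℝ) ≤ ((E.N (m + 1) : ℝ) / E.N m) ^ (1 / 16 : ℝ) :=
    Real.one_le_rpow ((one_le_div (hNpos m)).2 hNmono) (by norm_num)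
  calc E.θ (m + 1) = E.θ (m + 1) * 1 := (mul_one _).symm
    _ ≤ E.θ (m + 1) * ((E.N (m + 1) : ℝ) / E.N m) ^ (1 / 16 : ℝ) := mul_le_mul_of_nonneg_left hr (E.θ_pos _).le
    _ ≤ θ₀ := hT4 m

/-! ## §1 Second derivatives of the coarse drift, uniformly: `|∂_p∂_q (b_{≤m})_a| ≤ C₂·N_m·Σ_{i<m} a (i+1)` -/

/-- **Second label-derivatives of the coarse drift.**  For every design `W` there are `θs > 0` and `C₂ ≥ 0` such that for every
`LPermissible`, `Regular` carrier of design `W` with `N_m² ≤ N_{m+1}` and the template (T4) at `θ₀ ≤ θs`, every level `m`, time `t`,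
label `x` and indices: `|∂_p ∂_q (b_{≤m})_a (t, x)| ≤ C₂ · N_m · Σ_{i<m} a (i+1)` (the analytic tower at order two: each level `b (i+1)` is
analytic at radius `∼ 1/(ρ_* N_{i+1})` with amplitude `∼ a_{i+1}/N_{i+1}`, and `N_{i+1} ≤ N_m`).
[cite: ArmstrongVicol2025, App. A (A.1) and §2.2 (PDF p. 18)] -/
theorem abs_partialDeriv_partialDeriv_partialSum_le (k : ℕ) (W : LatticeWord k) : ∃ θs : ℝ, 0 < θs ∧ ∃ C₂ : ℝ, 0 ≤ C₂ ∧
    ∀ (E : LagrangianLatticeCarrier k) (θ₀ : ℝ), E.design = W → θ₀ ≤ θs → E.LPermissible → E.Regular →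
      (∀ m, E.N m ^ 2 ≤ E.N (m + 1)) → (∀ m, E.θ (m + 1) * ((E.N (m + 1) : ℝ) / E.N m) ^ (1 / 16 : ℝ) ≤ θ₀) →
      ∀ (m : ℕ) (t : ℝ) (x : UnitAddTorus (Fin 3)) (a p q : Fin 3),
        |Torus.partialDeriv p (Torus.partialDeriv q (fun z => E.partialSum m t z a)) x| ≤
          C₂ * E.N m * ∑ i ∈ Finset.range m, E.a (i + 1) := by
  obtain ⟨ρs, hρs, Cb, hCb, θH, hθH, tower⟩ := analytic_tower k W 1 one_pos
  refine ⟨θH, hθH, 2 / 3 * Cb * ρs ^ 2, by positivity, ?_⟩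
  intro E θ₀ hD hθs hLP hReg hsq hT4 m t x a p q
  have hLR := hReg.levelRegular
  have hN2 : ∀ m, 2 * E.N m ≤ E.N (m + 1) := hLP.permissible.2.2.1
  have hNpos : ∀ m, (0 : ℝ) < E.N m := fun m => by exact_mod_cast E.toFractalCarrierData.N_pos m
  have hdes : E.design = W.stretch 1 one_pos := by rw [stretch_one]; exact hD
  have hθ : ∀ i, E.θ (i + 1) ≤ θH := fun i => (theta_le_of_template E hLP hT4 i).trans hθs
  have hb := tower E hdes hLP hReg hθ hsq
  cases m with
  | zero =>
    have h0 : (fun z => E.partialSum 0 t z a) = fun _ => (0:ℝ) := by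
      funext z; simp [LagrangianLatticeCarrier.partialSum]
    have h1 : Torus.partialDeriv q (fun _ : UnitAddTorus (Fin 3) => (0:ℝ)) = fun _ => (0:ℝ) := by
      funext z; simp [Torus.partialDeriv, Torus.lineDeriv]
    rw [h0, h1]
    simp [Torus.partialDeriv, Torus.lineDeriv]
  | succ i =>
    have hS := dnorm_partialSum_le E hLR hN2 i (fun _ => ρs) (fun _ => hρs) (fun _ _ => le_rfl) (Cb := Cb)
      (fun j _ t c n => by rw [mul_div_assoc]; exact hb j t c n) (n := 2) (by norm_num) t
    have hsm : IsSmooth (E.partialSum (i + 1) t) := hLR.isSmooth_partialSum (i + 1) t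
    have hR : 0 < ρs * E.N (i + 1) := mul_pos hρs (hNpos _)
    have h1 := norm_iterPartialDeriv_le_of_dnorm_le hsm hR hS (l := [p, q]) rfl x
    have h2 : Torus.partialDeriv p (Torus.partialDeriv q (fun z => E.partialSum (i + 1) t z a)) x =
        (iterPartialDeriv [p, q] (E.partialSum (i + 1) t) x) a := by
      have := congrFun (iterPartialDeriv_apply_coord hsm a [p, q]) x
      simpa only [iterPartialDeriv_cons, iterPartialDeriv_nil] using this
    rw [h2]
    have h3 : |(iterPartialDeriv [p, q] (E.partialSum (i + 1) t) x) a| ≤ ‖iterPartialDeriv [p, q] (E.partialSum (i + 1) t) x‖ := by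
      simpa only [Real.norm_eq_abs] using PiLp.norm_apply_le (iterPartialDeriv [p, q] (E.partialSum (i + 1) t) x) a
    refine h3.trans (h1.trans (le_of_eq ?_))
    have hN := (hNpos (i + 1)).ne'
    simp only [Nat.factorial_two, Nat.cast_ofNat]
    field_simp
    ring

/-! ## §2 First label-derivatives of the displacement are at most one on the CLOSED piece -/

/-- **`|∂_c D_q| ≤ 1/10` on the closed piece.**  For every design `W` there is `θs > 0` such that, under the ceiling, for every level `m`,
window index `j` and `T ≤ refresh (m+1)`: `|∂_c (disp m (jR+u) (jR))_q (y)| ≤ 1/10` for all `u ∈ [0, T]` (the half-open window bound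
`‖∇X − id‖ ≤ 1/10` of `flowDeriv_sub_id_le_strain`, extended to `u = refresh (m+1)` by continuity of the Jacobian entries).
[cite: ArmstrongVicol2025, Prop. 2.2 (p. 19); §5.1] -/
theorem abs_partialDeriv_disp_le_tenth_closed (k : ℕ) (W : LatticeWord k) : ∃ θs : ℝ, 0 < θs ∧
    ∀ (E : LagrangianLatticeCarrier k) (θ₀ : ℝ), E.design = W → θ₀ ≤ θs → E.LPermissible → E.Regular →
      (∀ m, E.N m ^ 2 ≤ E.N (m + 1)) → (∀ m, E.θ (m + 1) * ((E.N (m + 1) : ℝ) / E.N m) ^ (1 / 16 : ℝ) ≤ θ₀) →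
      ∀ (m : ℕ) (j : ℤ) (T : ℝ), T ≤ E.refresh (m + 1) → ∀ u ∈ Icc 0 T, ∀ (c q : Fin 3) (y : UnitAddTorus (Fin 3)),
        |Torus.partialDeriv c (fun z => E.disp m ((j : ℝ) * E.refresh (m + 1) + u) ((j : ℝ) * E.refresh (m + 1)) z q) y| ≤ 1 / 10 := by
  obtain ⟨θs, hθs, C, hC, H⟩ := flowDeriv_sub_id_le_strain k W
  refine ⟨θs, hθs, fun E θ₀ hD hθ hLP hReg hsq hT4 m j T hT u hu c q y => ?_⟩
  have hLR := hReg.levelRegular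
  have hR0 : 0 < E.refresh (m + 1) := E.refresh_pos (m + 1)
  set s : ℝ := (j : ℝ) * E.refresh (m + 1) with hs
  -- the entry identity `∂_c D_q (u) = (∇X)_{qc} − δ_{qc}`
  have hentry : ∀ u' : ℝ, Torus.partialDeriv c (fun z => E.disp m (s + u') s z q) y =
      frameJac E m (s + u') s y q c - (1 : Matrix (Fin 3) (Fin 3) ℝ) q c := by
    intro u'
    rw [frameJac, Matrix.of_apply, hLR.flowDeriv_single_apply]; ring
  -- the half-open window: `≤ 1/10`
  have hopen : ∀ u' ∈ Ico (0:ℝ) (E.refresh (m + 1)),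
      |frameJac E m (s + u') s y q c - (1 : Matrix (Fin 3) (Fin 3) ℝ) q c| ≤ 1 / 10 := by
    intro u' hu'
    have hwin : s + u' ∈ E.window (m + 1) j := ⟨by rw [hs]; linarith [hu'.1], by rw [hs]; nlinarith [hu'.2]⟩
    obtain ⟨-, h⟩ := H E θ₀ hD hθ hLP hReg hsq hT4 m j (s + u') hwin y
    rw [frameJac, Matrix.of_apply, Matrix.one_apply]
    exact (abs_apply_single_sub_le_opNorm _ q c).trans h
  rcases lt_or_eq_of_le (hu.2.trans hT) with hlt | heq
  · rw [hentry]; exact hopen u ⟨hu.1, hlt⟩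
  · -- the endpoint `u = refresh (m+1)` by continuity of the Jacobian entry in the window time
    have hf : ContinuousWithinAt (fun u' => |frameJac E m (s + u') s y q c - (1 : Matrix (Fin 3) (Fin 3) ℝ) q c|)
        (Ico 0 (E.refresh (m + 1))) (E.refresh (m + 1)) := by
      have hc := continuousOn_frameJac_entry_closed E hLR m j (le_refl (E.refresh (m + 1))) y q c
      exact ((hc _ ⟨hR0.le, le_rfl⟩).sub continuousWithinAt_const).abs.mono Ico_subset_Icc_self
    have hg : ContinuousWithinAt (fun _ : ℝ => (1 / 10 : ℝ)) (Ico 0 (E.refresh (m + 1))) (E.refresh (m + 1)) :=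
      continuousWithinAt_const
    have hmem : E.refresh (m + 1) ∈ closure (Ico (0 : ℝ) (E.refresh (m + 1))) := by
      rw [closure_Ico hR0.ne]; exact ⟨hR0.le, le_rfl⟩
    have hlim := ContinuousWithinAt.closure_le hmem hf hg hopen
    rw [hentry, heq]
    exact hlim

/-! ## §3 The sharp second gradient of the displacement on the CLOSED piece -/

/-- **K8-5 (i): the sharp second gradient of the coarse-flow displacement.**  For every design `W` there are `θs > 0` and `C₂ ≥ 0`
such that for every `LPermissible`, `Regular` carrier of design `W` with `N_m² ≤ N_{m+1}` and the template (T4) at `θ₀ ≤ θs`, every level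
`m`, window index `j`, piece length `0 < T ≤ refresh (m+1)` and `u ∈ [0, T]`:
`|∂_e ∂_c (disp m (jR+u) (jR))_q (x)| ≤ C₂ · N_m · (Σ_{i<m} a (i+1)) · u` — LINEAR in the elapsed time and carrying the strain factor
(Grönwall on the second variational equation, `∇²D(0) = 0`, forcing `|∇²b_{≤m}| ≲ N_m Σ a_i`).
[cite: Hartman2002, Ch. V Thm 3.1, Cor. 4.1; ArmstrongVicol2025, App. A Prop. 7.10] -/
theorem abs_partialDeriv_partialDeriv_disp_le_closed (k : ℕ) (W : LatticeWord k) : ∃ θs : ℝ, 0 < θs ∧ ∃ C₂ : ℝ, 0 ≤ C₂ ∧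
    ∀ (E : LagrangianLatticeCarrier k) (θ₀ : ℝ), E.design = W → θ₀ ≤ θs → E.LPermissible → E.Regular →
      (∀ m, E.N m ^ 2 ≤ E.N (m + 1)) → (∀ m, E.θ (m + 1) * ((E.N (m + 1) : ℝ) / E.N m) ^ (1 / 16 : ℝ) ≤ θ₀) →
      ∀ (m : ℕ) (j : ℤ) (T : ℝ), 0 < T → T ≤ E.refresh (m + 1) → ∀ u ∈ Icc 0 T, ∀ (e c q : Fin 3) (x : UnitAddTorus (Fin 3)),
        |Torus.partialDeriv e (Torus.partialDeriv c
            (fun z => E.disp m ((j : ℝ) * E.refresh (m + 1) + u) ((j : ℝ) * E.refresh (m + 1)) z q)) x| ≤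
          C₂ * E.N m * ((∑ i ∈ Finset.range m, E.a (i + 1)) * u) := by
  obtain ⟨θ₁, hθ₁, C', hC', H1⟩ := abs_partialDeriv_partialSum_le k W
  obtain ⟨θ₂, hθ₂, C₂, hC₂, H2⟩ := abs_partialDeriv_partialDeriv_partialSum_le k W
  obtain ⟨θ₃, hθ₃, H3⟩ := abs_partialDeriv_disp_le_tenth_closed k W
  refine ⟨min (min θ₁ θ₂) (min θ₃ (1 / (3 * C' + 1))), lt_min (lt_min hθ₁ hθ₂) (lt_min hθ₃ (by positivity)),
    108 * C₂, by positivity, ?_⟩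
  intro E θ₀ hD hθs hLP hReg hsq hT4 m j T hT0 hT u hu e c q x
  have hθs₁ : θ₀ ≤ θ₁ := hθs.trans ((min_le_left _ _).trans (min_le_left _ _))
  have hθs₂ : θ₀ ≤ θ₂ := hθs.trans ((min_le_left _ _).trans (min_le_right _ _))
  have hθs₃ : θ₀ ≤ θ₃ := hθs.trans ((min_le_right _ _).trans (min_le_left _ _))
  have hθs₄ : θ₀ ≤ 1 / (3 * C' + 1) := hθs.trans ((min_le_right _ _).trans (min_le_right _ _))
  have hLR := hReg.levelRegular
  have hF : E.IsFlow m := (hLP.isLagrangian m).1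
  have hNpos : (0 : ℝ) < E.N m := by exact_mod_cast E.toFractalCarrierData.N_pos m
  set s : ℝ := (j : ℝ) * E.refresh (m + 1) with hs
  set S : ℝ := ∑ i ∈ Finset.range m, E.a (i + 1) with hSdef
  have hS0 : 0 ≤ S := Finset.sum_nonneg fun i _ => (E.toFractalCarrierData.a_pos _).le
  -- the strain budget on the piece: `S·T ≤ S·R = strain m ≤ θ (m+1) ≤ θ₀`
  have hstrain : S * T ≤ θ₀ :=
    calc S * T ≤ S * E.refresh (m + 1) := mul_le_mul_of_nonneg_left hT hS0
      _ = E.strain m := by rw [hSdef, LagrangianLatticeCarrier.strain]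
      _ ≤ E.θ (m + 1) := hLP.strain_le m
      _ ≤ θ₀ := theta_le_of_template E hLP hT4 m
  -- the window clauses on the CLOSED piece and the chain rule on steroids within it
  obtain ⟨hbc, hbs, hbB, -⟩ := hLR.window_b_clauses m s T
  obtain ⟨hDc, hDs, hDB⟩ := FrameConj.window_disp_clauses_closed E hLR m j hT
  have hint : ∀ s' ∈ Icc 0 T, ∀ x, E.disp m (s + s') s x =
      ∫ r in (0 : ℝ)..s', E.partialSum m (s + r) (x + proj (E.disp m (s + r) s x)) := fun s' _ x => hF.window_integral_eq s s' x
  have hDt := hasDerivWithinAt_iterPartialDeriv_disp hbc hbs hbB hDc hDs hDB hint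
  have hcard : (Fintype.card (Fin 3) : ℝ) * (C' * S) * T ≤ 1 := by
    rw [Fintype.card_fin]
    push_cast
    have h1 : 3 * C' * (S * T) ≤ 3 * C' * θ₀ := mul_le_mul_of_nonneg_left hstrain (by positivity)
    have h2 : 3 * C' * θ₀ ≤ 1 := by
      have h := mul_le_mul_of_nonneg_left hθs₄ (by positivity : (0:ℝ) ≤ 3 * C' + 1)
      rw [mul_one_div_cancel (by positivity)] at h
      have hθ0 : 0 ≤ θ₀ := le_trans (mul_nonneg hS0 hT0.le) hstrain
      nlinarith
    nlinarith
  have key := abs_partialDeriv_partialDeriv_disp_le_forward_ofDerivWithin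
    (f := fun r => E.partialSum m (s + r)) (D := fun r => E.disp m (s + r) s)
    (fun r => hLR.isSmooth_partialSum m _) (fun r => hLR.isSmooth_disp m _ _)
    (fun x => by simpa using disp_self_of_isFlow E hF s x)
    (T₀ := T) (B₁ := C' * S) (B₂ := C₂ * E.N m * S) (mul_nonneg hC' hS0) (by positivity)
    (fun l i x t ht => hDt l i x ht)
    (fun t q' a' z => H1 E θ₀ hD hθs₁ hLP hReg hsq hT4 m (s + t) z a' q')
    (fun t p' q' a' z => H2 E θ₀ hD hθs₂ hLP hReg hsq hT4 m (s + t) z a' p' q')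
    (fun t ht c' q' z => (H3 E θ₀ hD hθs₃ hLP hReg hsq hT4 m j T hT t ht c' q' z).trans (by norm_num))
    hcard hu e c q x
  refine key.trans (le_of_eq ?_)
  rw [Fintype.card_fin]
  push_cast
  ring

end Summit.AnomalousDissipation.AnomalousDissipation.Theorems.SolenoidalFractalHomogenisation.LagrangianStep.FrameForm

end
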